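import Summits.AnomalousDissipation.AnomalousDissipation.Theorems.IsotropicCubatureWord
import Literature.Analysis.FluidPDE.PassiveVectorSuperposition
import Literature.Analysis.FunctionSpaces.TorusSobolevNormProofs
import HarnessLib

/-!
# K2R `RealisedQuasiStaticCellLaw`, line `floquet-bloch`: the Bloch-sector reduction of `stub_lowerSome`

Summits-side helper (everything proved; no definitions, no named facts; `--supports stmt-AnomalousDissipation-20446`).
The registered stub `stub_lowerSome` of line `floquet-bloch` of the crux `RealisedQuasiStaticCellLaw` (route
`SolenoidalFractalHomogenisation`, item stmt-AnomalousDissipation-20446) — for every `H¹` divergence-free mean-zero datum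
around the `1/n`-cells of the quasi-statically replayed stretched cubature word there is SOME weak `A = 0` solution with
the enhanced upper energy bound `(K/ν)·exp(−8π²(1 + (1−δ)c_W/ν²)(ν/n²)t)` — FOLLOWS from the two registered sector stubs
of skeleton r14 (`ledger skeleton check` 2026-08-27T11:55Z):

* `S0 = stub_sectorPieces`: Bloch decomposition of the datum into finitely many `H¹` divergence-free mean-zero pieces
  supported in pairwise disjoint symmetric sectors `{k | k ≡ ±ℓ (mod n)}`;
* `S1 = stub_lowerSomeSector`: the one-sector version of `stub_lowerSome` with a sector-preserving solution and
  sector-uniform constants.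

`lowerSome_of_sectorStubs : S0 → S1 → stub_lowerSome` (statements verbatim, hypotheses written out): one solution per
piece, summed by `Torus.IsWeakPassiveVectorOn.finset_sum`, energies read sector by sector with
`Torus.integral_norm_sq_finset_sum_eq_of_mFourierCoeff_disjoint` (both `Literature.Analysis.FluidPDE.PassiveVectorSuperposition`).
This is the kernel-checked form of «uniformly in all data ⇐ uniformly in all Bloch sectors» for the LINEAR cell problem
(the carrier `W.cell n` is `1/n`-periodic, so the sectors `ℓ + nℤ³` are invariant; reality pairs `ℓ` with `−ℓ`).
-/

set_option linter.dupNamespace false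

noncomputable section

namespace Summit.AnomalousDissipation.AnomalousDissipation.Theorems.SolenoidalFractalHomogenisation.RealisedQuasiStaticCellLaw

open Set MeasureTheory
open scoped InnerProductSpace
open Literature.Analysis Literature.Analysis.FluidPDE Literature.Analysis.FluidPDE.LatticeShear
open Summit.AnomalousDissipation.AnomalousDissipation.Theorems (cubatureWord c0)

/-- `H¹` real vector fields on `T³` (spectrally, through the complexification) are in `L²(T³; ℝ³)`
(`H¹ ⊆ H⁰ = L²`, `Torus.MemSobolev.memLp_two_holds`; `complexify` is an isometric embedding). -/
theorem memLp_two_of_memSobolev_one_complexify {v : UnitAddTorus (Fin 3) → EuclideanSpace ℝ (Fin 3)}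
    (h : FunctionSpaces.Torus.MemSobolev 1 (FunctionSpaces.EuclideanSpace.complexify ∘ v)) : MemLp v 2 volume := by
  have h2 : MemLp (FunctionSpaces.EuclideanSpace.complexify ∘ v) 2 volume :=
    FunctionSpaces.Torus.MemSobolev.memLp_two_holds h zero_le_one
  have hm : AEStronglyMeasurable v volume :=
    (FunctionSpaces.EuclideanSpace.complexify (ι := Fin 3)).isometry.isEmbedding.aestronglyMeasurable_comp_iff.1 h2.1
  refine h2.of_le hm (ae_of_all _ fun x => ?_)
  simp only [Function.comp_apply, FunctionSpaces.EuclideanSpace.norm_complexify, le_refl]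

/-- **`stub_lowerSome` from the sector stubs (Bloch-sector superposition).** If (S0) every `H¹` weakly divergence-free
mean-zero datum on `T³` splits into finitely many such pieces supported in pairwise disjoint symmetric Bloch sectors
`k ≡ ±ℓ (mod n)`, and (S1) every sector-supported datum admits, in a regime `(M₀; ν₀, K)` uniform over the sectors, a weak
`A = 0` solution around the `1/n`-cells of the quasi-statically replayed stretched cubature word which stays in its sector and
obeys the enhanced upper energy bound, then EVERY `H¹` divergence-free mean-zero datum admits a weak solution with that bound
(the registered `stub_lowerSome` of line `floquet-bloch`, verbatim): sum the sector solutions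
(`IsWeakPassiveVectorOn.finset_sum`) and add the energies sector by sector at time `t` and at time `0`
(`integral_norm_sq_finset_sum_eq_of_mFourierCoeff_disjoint`). -/
theorem lowerSome_of_sectorStubs
    (hS0 : ∀ n : ℕ, 0 < n → ∀ w₀ : UnitAddTorus (Fin 3) → EuclideanSpace ℝ (Fin 3),
    FunctionSpaces.Torus.MemSobolev 1 (FunctionSpaces.EuclideanSpace.complexify ∘ w₀) →
    FunctionSpaces.Torus.IsWeaklyDivFree w₀ → FunctionSpaces.Torus.HasZeroMean w₀ →
    ∃ ι : Finset (Fin 3 → ℤ), ∃ v : (Fin 3 → ℤ) → UnitAddTorus (Fin 3) → EuclideanSpace ℝ (Fin 3),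
      (∀ ℓ ∈ ι, FunctionSpaces.Torus.MemSobolev 1 (FunctionSpaces.EuclideanSpace.complexify ∘ v ℓ) ∧
        FunctionSpaces.Torus.IsWeaklyDivFree (v ℓ) ∧ FunctionSpaces.Torus.HasZeroMean (v ℓ) ∧
        ∀ k : Fin 3 → ℤ, ¬ ((∃ z : Fin 3 → ℤ, k = ℓ + (n:ℤ) • z) ∨ (∃ z : Fin 3 → ℤ, k = -ℓ + (n:ℤ) • z)) →
          UnitAddTorus.mFourierCoeff (FunctionSpaces.EuclideanSpace.complexify ∘ v ℓ) k = 0) ∧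
      (∀ ℓ ∈ ι, ∀ ℓ' ∈ ι, ℓ ≠ ℓ' → ∀ k : Fin 3 → ℤ,
        ((∃ z : Fin 3 → ℤ, k = ℓ + (n:ℤ) • z) ∨ (∃ z : Fin 3 → ℤ, k = -ℓ + (n:ℤ) • z)) →
        ¬ ((∃ z : Fin 3 → ℤ, k = ℓ' + (n:ℤ) • z) ∨ (∃ z : Fin 3 → ℤ, k = -ℓ' + (n:ℤ) • z))) ∧
      w₀ = fun x => ∑ ℓ ∈ ι, v ℓ x)
    (hS1 : ∀ δ > (0:ℝ), ∃ M₀ > (0:ℝ), ∀ M : ℝ, ∀ hM : 0 < M, M₀ ≤ M → ∃ ν₀ > (0:ℝ), ∃ K > (0:ℝ),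
    ∀ ν, ∀ hν : ν ∈ Ioo 0 ν₀, ∀ n : ℕ, ⌈K / ν⌉₊ ≤ n → ∀ ℓ : Fin 3 → ℤ,
    ∀ w₀ : UnitAddTorus (Fin 3) → EuclideanSpace ℝ (Fin 3),
      FunctionSpaces.Torus.MemSobolev 1 (FunctionSpaces.EuclideanSpace.complexify ∘ w₀) →
      FunctionSpaces.Torus.IsWeaklyDivFree w₀ → FunctionSpaces.Torus.HasZeroMean w₀ →
      (∀ k : Fin 3 → ℤ, ¬ ((∃ z : Fin 3 → ℤ, k = ℓ + (n:ℤ) • z) ∨ (∃ z : Fin 3 → ℤ, k = -ℓ + (n:ℤ) • z)) →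
        UnitAddTorus.mFourierCoeff (FunctionSpaces.EuclideanSpace.complexify ∘ w₀) k = 0) → ∀ T > (0:ℝ),
      ∃ w, Torus.IsWeakPassiveVectorOn 0 T (ν / (n:ℝ) ^ 2)
          (((cubatureWord.stretch M hM).stretch (1 / ν) (one_div_pos.mpr hν.1)).cell n) w₀ w ∧
        (∀ᵐ t ∂(volume.restrict (Ioo 0 T)), ∀ k : Fin 3 → ℤ,
          ¬ ((∃ z : Fin 3 → ℤ, k = ℓ + (n:ℤ) • z) ∨ (∃ z : Fin 3 → ℤ, k = -ℓ + (n:ℤ) • z)) →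
          UnitAddTorus.mFourierCoeff (FunctionSpaces.EuclideanSpace.complexify ∘ w t) k = 0) ∧
        ∀ᵐ t ∂(volume.restrict (Ioo 0 T)),
          ∫ x, ‖w t x‖ ^ 2 ≤ (K / ν) *
            Real.exp (-(8 * Real.pi ^ 2 * (1 + (1 - δ) * ((1 - 4 * cubatureWord.ramp / 3) * c0) / ν ^ 2) * ν
              / (n:ℝ) ^ 2) * t) * ∫ x, ‖w₀ x‖ ^ 2) :
    ∀ δ > (0:ℝ), ∃ M₀ > (0:ℝ), ∀ M : ℝ, ∀ hM : 0 < M, M₀ ≤ M → ∃ ν₀ > (0:ℝ), ∃ K > (0:ℝ),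
    ∀ ν, ∀ hν : ν ∈ Ioo 0 ν₀, ∀ n : ℕ, ⌈K / ν⌉₊ ≤ n →
    ∀ w₀ : UnitAddTorus (Fin 3) → EuclideanSpace ℝ (Fin 3),
      FunctionSpaces.Torus.MemSobolev 1 (FunctionSpaces.EuclideanSpace.complexify ∘ w₀) →
      FunctionSpaces.Torus.IsWeaklyDivFree w₀ → FunctionSpaces.Torus.HasZeroMean w₀ → ∀ T > (0:ℝ),
      ∃ w, Torus.IsWeakPassiveVectorOn 0 T (ν / (n:ℝ) ^ 2)
          (((cubatureWord.stretch M hM).stretch (1 / ν) (one_div_pos.mpr hν.1)).cell n) w₀ w ∧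
        ∀ᵐ t ∂(volume.restrict (Ioo 0 T)),
          ∫ x, ‖w t x‖ ^ 2 ≤ (K / ν) *
            Real.exp (-(8 * Real.pi ^ 2 * (1 + (1 - δ) * ((1 - 4 * cubatureWord.ramp / 3) * c0) / ν ^ 2) * ν
              / (n:ℝ) ^ 2) * t) * ∫ x, ‖w₀ x‖ ^ 2 := by
  intro δ hδ
  obtain ⟨M₀, hM₀, H⟩ := hS1 δ hδ
  refine ⟨M₀, hM₀, fun M hM hle => ?_⟩
  obtain ⟨ν₀, hν₀, K, hK, H1⟩ := H M hM hle
  refine ⟨ν₀, hν₀, K, hK, ?_⟩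
  intro ν hν n hn w₀ hw₀ hdiv hmean T hT
  -- abbreviations
  set b := ((cubatureWord.stretch M hM).stretch (1 / ν) (one_div_pos.mpr hν.1)).cell n with hb
  set E : ℝ → ℝ := fun t => (K / ν) *
    Real.exp (-(8 * Real.pi ^ 2 * (1 + (1 - δ) * ((1 - 4 * cubatureWord.ramp / 3) * c0) / ν ^ 2) * ν
      / (n:ℝ) ^ 2) * t) with hE
  have hn0 : 0 < n := lt_of_lt_of_le (Nat.ceil_pos.mpr (div_pos hK hν.1)) hn
  obtain ⟨ι, v, hv, hdisj, hsum⟩ := hS0 n hn0 w₀ hw₀ hdiv hmean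
  -- one solution per sector piece
  have Hsol : ∀ ℓ ∈ ι, ∃ w, Torus.IsWeakPassiveVectorOn 0 T (ν / (n:ℝ) ^ 2) b (v ℓ) w ∧
      (∀ᵐ t ∂(volume.restrict (Ioo 0 T)),
        ∀ k : Fin 3 → ℤ, ¬ ((∃ z : Fin 3 → ℤ, k = ℓ + (n:ℤ) • z) ∨ (∃ z : Fin 3 → ℤ, k = -ℓ + (n:ℤ) • z)) →
          UnitAddTorus.mFourierCoeff (FunctionSpaces.EuclideanSpace.complexify ∘ w t) k = 0) ∧
      ∀ᵐ t ∂(volume.restrict (Ioo 0 T)), ∫ x, ‖w t x‖ ^ 2 ≤ E t * ∫ x, ‖v ℓ x‖ ^ 2 :=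
    fun ℓ hℓ => H1 ν hν n hn ℓ (v ℓ) (hv ℓ hℓ).1 (hv ℓ hℓ).2.1 (hv ℓ hℓ).2.2.1 (hv ℓ hℓ).2.2.2 T hT
  by_cases hι : ι.Nonempty
  · choose! Wsol hW using Hsol
    refine ⟨fun t x => ∑ ℓ ∈ ι, Wsol ℓ t x, ?_, ?_⟩
    · rw [hsum]
      exact Torus.IsWeakPassiveVectorOn.finset_sum ι hι
        (fun ℓ hℓ => (memLp_two_of_memSobolev_one_complexify (hv ℓ hℓ).1).integrable one_le_two) (fun ℓ hℓ => (hW ℓ hℓ).1)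
    · -- collect the a.e. statements of the finitely many sector solutions
      have hae_supp : ∀ᵐ t ∂(volume.restrict (Ioo 0 T)), ∀ ℓ ∈ ι,
          ∀ k : Fin 3 → ℤ, ¬ ((∃ z : Fin 3 → ℤ, k = ℓ + (n:ℤ) • z) ∨ (∃ z : Fin 3 → ℤ, k = -ℓ + (n:ℤ) • z)) →
            UnitAddTorus.mFourierCoeff (FunctionSpaces.EuclideanSpace.complexify ∘ Wsol ℓ t) k = 0 :=
        (ae_ball_iff ι.countable_toSet).2 fun ℓ hℓ => (hW ℓ hℓ).2.1
      have hae_bd : ∀ᵐ t ∂(volume.restrict (Ioo 0 T)), ∀ ℓ ∈ ι,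
          ∫ x, ‖Wsol ℓ t x‖ ^ 2 ≤ E t * ∫ x, ‖v ℓ x‖ ^ 2 :=
        (ae_ball_iff ι.countable_toSet).2 fun ℓ hℓ => (hW ℓ hℓ).2.2
      have hae_L2 : ∀ᵐ t ∂(volume.restrict (Ioo 0 T)), ∀ ℓ ∈ ι, MemLp (Wsol ℓ t) 2 volume :=
        (ae_ball_iff ι.countable_toSet).2 fun ℓ hℓ => (hW ℓ hℓ).1.ae_memLp_two
      filter_upwards [hae_supp, hae_bd, hae_L2] with t hsupp hbd hL2
      -- energies add at time `t` and at time `0`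
      have hdisj_t : ∀ ℓ ∈ ι, ∀ ℓ' ∈ ι, ℓ ≠ ℓ' → ∀ k : Fin 3 → ℤ,
          UnitAddTorus.mFourierCoeff (FunctionSpaces.EuclideanSpace.complexify ∘ Wsol ℓ t) k = 0 ∨
            UnitAddTorus.mFourierCoeff (FunctionSpaces.EuclideanSpace.complexify ∘ Wsol ℓ' t) k = 0 := by
        intro ℓ hℓ ℓ' hℓ' hne k
        by_cases hk : ((∃ z : Fin 3 → ℤ, k = ℓ + (n:ℤ) • z) ∨ (∃ z : Fin 3 → ℤ, k = -ℓ + (n:ℤ) • z))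
        · exact Or.inr (hsupp ℓ' hℓ' k (hdisj ℓ hℓ ℓ' hℓ' hne k hk))
        · exact Or.inl (hsupp ℓ hℓ k hk)
      have hdisj_0 : ∀ ℓ ∈ ι, ∀ ℓ' ∈ ι, ℓ ≠ ℓ' → ∀ k : Fin 3 → ℤ,
          UnitAddTorus.mFourierCoeff (FunctionSpaces.EuclideanSpace.complexify ∘ v ℓ) k = 0 ∨
            UnitAddTorus.mFourierCoeff (FunctionSpaces.EuclideanSpace.complexify ∘ v ℓ') k = 0 := by
        intro ℓ hℓ ℓ' hℓ' hne k
        by_cases hk : ((∃ z : Fin 3 → ℤ, k = ℓ + (n:ℤ) • z) ∨ (∃ z : Fin 3 → ℤ, k = -ℓ + (n:ℤ) • z))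
        · exact Or.inr ((hv ℓ' hℓ').2.2.2 k (hdisj ℓ hℓ ℓ' hℓ' hne k hk))
        · exact Or.inl ((hv ℓ hℓ).2.2.2 k hk)
      rw [Torus.integral_norm_sq_finset_sum_eq_of_mFourierCoeff_disjoint ι hL2 hdisj_t, hsum]
      rw [Torus.integral_norm_sq_finset_sum_eq_of_mFourierCoeff_disjoint ι
        (fun ℓ hℓ => memLp_two_of_memSobolev_one_complexify (hv ℓ hℓ).1) hdisj_0, Finset.mul_sum]
      exact Finset.sum_le_sum fun ℓ hℓ => hbd ℓ hℓ
  · -- no piece: the datum is `0`, which lies in every sector; take the sector solution for `ℓ = 0`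
    rw [Finset.not_nonempty_iff_eq_empty] at hι
    have hw0 : w₀ = fun _ => 0 := by rw [hsum, hι]; simp
    have hsupp0 : ∀ k : Fin 3 → ℤ, ¬ ((∃ z : Fin 3 → ℤ, k = (0 : Fin 3 → ℤ) + (n:ℤ) • z) ∨ (∃ z : Fin 3 → ℤ, k = -(0 : Fin 3 → ℤ) + (n:ℤ) • z)) →
        UnitAddTorus.mFourierCoeff (FunctionSpaces.EuclideanSpace.complexify ∘ w₀) k = 0 := by
      intro k _
      rw [hw0]
      have : (FunctionSpaces.EuclideanSpace.complexify ∘ fun _ : UnitAddTorus (Fin 3) => (0 : EuclideanSpace ℝ (Fin 3))) =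
          fun _ => 0 := by funext x; simp
      rw [this, FunctionSpaces.Torus.mFourierCoeff_eq_integral_volume]
      simp
    obtain ⟨w, hw, -, hbd⟩ := H1 ν hν n hn 0 w₀ hw₀ hdiv hmean hsupp0 T hT
    exact ⟨w, hw, hbd⟩

end Summit.AnomalousDissipation.AnomalousDissipation.Theorems.SolenoidalFractalHomogenisation.RealisedQuasiStaticCellLaw

end
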